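import Summits.NavierStokesRegularity.NavierStokesRegularity.Theorems.ExtremiserTransienceNearExtremalTransienceScaling
import Literature.Analysis.FluidPDE.WholeSpaceIBP
import HarnessLib

/-!
# Crux `ExtremiserTransience.NearExtremalTransience` (stmt-NavierStokesRegularity-21883), line `extremiser_liouville`,
# stub K1b — DENSITY LEAF, part 1: the SCALED Bogovskiĭ corrector on the annuli `A(ρ/2, 3ρ)` with scale-free constants

`--supports stmt-NavierStokesRegularity-21883` (helper).  Author: prover seat `ns-el-k1b` (g0).

The density leaf of K1b (hypothesis `hdens` of `ExtremiserLiouville.extendedSharp_of_density`) truncates the decaying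
tail `w − c` of a field of the stub's extended class by `χ_ρ (w − c) − v_ρ`, where `div v_ρ = ∇χ_ρ · (w − c)` on the
annulus carrying `∇χ_ρ`.  This file supplies the corrector family from the unit-annulus statement — Bogovskiĭ's smooth
compactly supported right inverse of the divergence, typed as the Literature fact
`Literature.Analysis.FluidPDE.bogovskii_annulus_smooth_corrector` (`Literature/Analysis/FluidPDE/BogovskiiOperator.lean`,
proposal p619506; Galdi 2011 L. III.3.1 / Shibata 2020 L. 3.8.6), taken here as the HYPOTHESIS `hB` (stated verbatim, so
that `hB := bogovskii_annulus_smooth_corrector` discharges it once that file is in the tree) — by DILATION: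
if `div vu = g` on `A(1/2, 3)` with `g(y) = ρ f(ρ y)`, then `v(x) = vu(x/ρ)` solves `div v = f` on `A(ρ/2, 3ρ)` and
`‖Dv‖_q = ρ^(3/q−1)‖Dvu‖_q ≤ C ρ^(3/q−1)‖g‖_q = C‖f‖_q`, `‖D²v‖_q ≤ C(ρ⁻¹‖f‖_q + ‖Df‖_q)` — the constant of the unit
annulus serves ALL scales (`scaledCorrector`).  Also: the datum `∇χ·u` of a divergence-free `u` has zero mean
(`integral_fderiv_apply_eq_zero_of_isDivFree`: `∇χ·u = div(χu)` and the divergence theorem without boundary).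

WHAT THIS IS NOT: not the density leaf (its far-field limit, Morrey bound and truncation estimates are not here); the
corrector statement is a named published fact taken as hypothesis; nothing about Navier–Stokes; NS regularity is NOT
proved by anything here. [folklore]
-/

noncomputable section

open Set Filter Topology MeasureTheory Metric Function
open scoped InnerProductSpace RealInnerProductSpace ENNReal NNReal ContDiff
open Literature.Analysis.FluidPDE

namespace Summit.NavierStokesRegularity.NavierStokesRegularity.Theorems

-- the problem directory repeats the summit name (`NavierStokesRegularity/NavierStokesRegularity`)
set_option linter.dupNamespace false
-- nested operator types `ℝ³ →L[ℝ] ℝ³ →L[ℝ] ℝ³`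
set_option maxSynthPendingDepth 3

namespace ExtremiserLiouville

/-! ## Change of variables and dilation calculus on `ℝ³` -/

/-- `‖h(c ·)‖_{L^p(ℝ³)} = |c³|^(−1/p) ‖h‖_{L^p}` for `c ≠ 0` (any normed target; Mathlib's `Measure.map_addHaar_smul`). [folklore] -/
theorem eLpNorm_comp_smul_three' {F : Type*} [NormedAddCommGroup F] (p : ℝ≥0∞) (h : EuclideanSpace ℝ (Fin 3) → F) {c : ℝ}
    (hc : c ≠ 0) :
    eLpNorm (fun x => h (c • x)) p volume = ENNReal.ofReal |(c ^ 3)⁻¹| ^ (1 / p).toReal * eLpNorm h p volume := by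
  have hemb : MeasurableEmbedding (fun x : EuclideanSpace ℝ (Fin 3) => c • x) :=
    (Homeomorph.smul (Units.mk0 c hc)).measurableEmbedding
  have h0 : ENNReal.ofReal |(c ^ 3)⁻¹| ≠ 0 :=
    (ENNReal.ofReal_pos.2 (abs_pos.2 (inv_ne_zero (pow_ne_zero _ hc)))).ne'
  rw [← Function.comp_def h, ← hemb.eLpNorm_map_measure, Measure.map_addHaar_smul volume hc,
    finrank_euclideanSpace_fin, eLpNorm_smul_measure_of_ne_zero h0, smul_eq_mul]

/-- The two change-of-variables factors at reciprocal scales cancel: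
`|((c⁻¹)³)⁻¹|^a · |(c³)⁻¹|^a = 1`. [folklore] -/
theorem scaleFactors_mul_eq_one {c : ℝ} (hc : c ≠ 0) (a : ℝ) :
    ENNReal.ofReal |((c⁻¹) ^ 3)⁻¹| ^ a * ENNReal.ofReal |(c ^ 3)⁻¹| ^ a = 1 := by
  rw [← ENNReal.mul_rpow_of_ne_top ENNReal.ofReal_ne_top ENNReal.ofReal_ne_top,
    ← ENNReal.ofReal_mul (abs_nonneg _), ← abs_mul, inv_pow, inv_inv, mul_inv_cancel₀ (pow_ne_zero 3 hc),
    abs_one, ENNReal.ofReal_one, ENNReal.one_rpow]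

/-- `‖c‖ₑ · ‖c⁻¹‖ₑ = 1` in `ℝ≥0∞` for `c ≠ 0`. [folklore] -/
theorem enorm_mul_enorm_inv {c : ℝ} (hc : c ≠ 0) : ‖c‖ₑ * ‖c⁻¹‖ₑ = 1 := by
  rw [← enorm_mul, mul_inv_cancel₀ hc, enorm_one]

/-! ## Zero mean of the truncation datum -/

/-- **The datum `∇χ · u` of a divergence-free field has zero mean**: `∫ Dχ(x)(u x) dx = 0` for `χ ∈ C¹_c` scalar (more
generally `χ` smooth with `∇χ` compactly supported is what the density leaf uses; here `χ u` compactly supported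
suffices) and `u ∈ C¹` divergence free, since `Dχ·u = div(χ u)` and `∫ div = 0` (tree `integral_divergence_eq_zero`). [folklore] -/
theorem integral_fderiv_apply_eq_zero_of_isDivFree {χ : EuclideanSpace ℝ (Fin 3) → ℝ} {u : EuclideanSpace ℝ (Fin 3) → EuclideanSpace ℝ (Fin 3)}
    (hχ : ContDiff ℝ 1 χ) (hu : ContDiff ℝ 1 u) (hdiv : VectorCalculus.IsDivFree u)
    (hc : HasCompactSupport fun x => χ x • u x) :
    ∫ x, fderiv ℝ χ x (u x) = 0 := by
  have hχu : ContDiff ℝ 1 fun x => χ x • u x := hχ.smul hu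
  have hpt : ∀ x, VectorCalculus.divergence (fun y => χ y • u y) x = fderiv ℝ χ x (u x) := by
    intro x
    have hχd : DifferentiableAt ℝ χ x := hχ.differentiable (by simp) x
    have hud : DifferentiableAt ℝ u x := hu.differentiable (by simp) x
    unfold VectorCalculus.divergence
    rw [fderiv_fun_smul hχd hud]
    push_cast
    rw [map_add, LinearMap.map_smul]
    have h1 : LinearMap.trace ℝ _ ((fderiv ℝ u x : EuclideanSpace ℝ (Fin 3) →L[ℝ] EuclideanSpace ℝ (Fin 3)) : EuclideanSpace ℝ (Fin 3) →ₗ[ℝ] EuclideanSpace ℝ (Fin 3)) = 0 := hdiv x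
    have h2 : LinearMap.trace ℝ _ (((fderiv ℝ χ x).smulRight (u x) : EuclideanSpace ℝ (Fin 3) →L[ℝ] EuclideanSpace ℝ (Fin 3)) : EuclideanSpace ℝ (Fin 3) →ₗ[ℝ] EuclideanSpace ℝ (Fin 3)) =
        fderiv ℝ χ x (u x) := by
      rw [ContinuousLinearMap.coe_smulRight, LinearMap.trace_smulRight]
      rfl
    rw [h1, h2, smul_zero, zero_add]
  have h := integral_divergence_eq_zero hχu hc
  simp_rw [hpt] at h
  exact h

/-! ## The scaled corrector -/


/-- **THE SCALED BOGOVSKIĬ CORRECTOR (density leaf, part 1).**  Assume the unit-annulus statement `hB` (= the Literature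
fact `bogovskii_annulus_smooth_corrector`, verbatim).  Then for every `1 < q < ∞` there is ONE constant `C` such that for
EVERY scale `ρ > 0` and every `f ∈ C^∞_c(A(ρ/2, 3ρ))` with `∫ f = 0` there is `v ∈ C^∞_c(A(ρ/2, 3ρ); ℝ³)` with
`div v = f`, `‖Dv‖_{L^q} ≤ C‖f‖_{L^q}` and `‖D(Dv)‖_{L^q} ≤ C(ρ⁻¹‖f‖_{L^q} + ‖Df‖_{L^q})` (dilation `v = vu(·/ρ)` of
the unit-annulus solution for the datum `g = ρ f(ρ ·)`). [folklore] -/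
theorem scaledCorrector
    (hB : ∀ (r₁ r₂ : ℝ), 0 < r₁ → r₁ < r₂ → ∀ (q : ℝ≥0∞), 1 < q → q < ⊤ →
      ∃ C : ℝ≥0, ∀ (f : EuclideanSpace ℝ (Fin 3) → ℝ), ContDiff ℝ (⊤ : ℕ∞) f →
      tsupport f ⊆ {x : EuclideanSpace ℝ (Fin 3) | r₁ < ‖x‖ ∧ ‖x‖ < r₂} → ∫ x, f x = 0 →
      ∃ v : EuclideanSpace ℝ (Fin 3) → EuclideanSpace ℝ (Fin 3),
      ContDiff ℝ (⊤ : ℕ∞) v ∧ HasCompactSupport v ∧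
      tsupport v ⊆ {x : EuclideanSpace ℝ (Fin 3) | r₁ < ‖x‖ ∧ ‖x‖ < r₂} ∧
      (∀ x, VectorCalculus.divergence v x = f x) ∧
      eLpNorm (fun x => fderiv ℝ v x) q volume ≤ C * eLpNorm f q volume ∧
      eLpNorm (fun x => iteratedFDeriv ℝ 2 v x) q volume ≤
      C * (eLpNorm f q volume + eLpNorm (fun x => fderiv ℝ f x) q volume))
    {q : ℝ≥0∞} (hq1 : 1 < q) (hqtop : q < ⊤) :
    ∃ C : ℝ≥0, ∀ (ρ : ℝ), 0 < ρ → ∀ (f : EuclideanSpace ℝ (Fin 3) → ℝ), ContDiff ℝ (⊤ : ℕ∞) f →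
      tsupport f ⊆ {x : EuclideanSpace ℝ (Fin 3) | ρ / 2 < ‖x‖ ∧ ‖x‖ < 3 * ρ} → ∫ x, f x = 0 →
      ∃ v : EuclideanSpace ℝ (Fin 3) → EuclideanSpace ℝ (Fin 3), ContDiff ℝ (⊤ : ℕ∞) v ∧ HasCompactSupport v ∧
        tsupport v ⊆ {x : EuclideanSpace ℝ (Fin 3) | ρ / 2 < ‖x‖ ∧ ‖x‖ < 3 * ρ} ∧
        (∀ x, VectorCalculus.divergence v x = f x) ∧
        eLpNorm (fun x => fderiv ℝ v x) q volume ≤ C * eLpNorm f q volume ∧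
        eLpNorm (fun x => fderiv ℝ (fderiv ℝ v) x) q volume ≤
          C * ((ENNReal.ofReal ρ)⁻¹ * eLpNorm f q volume + eLpNorm (fun x => fderiv ℝ f x) q volume) := by
  obtain ⟨C, hC⟩ := hB (1 / 2) 3 (by norm_num) (by norm_num) q hq1 hqtop
  refine ⟨C, fun ρ hρ f hf hsupp hmean => ?_⟩
  have hρ0 : ρ ≠ 0 := hρ.ne'
  -- the rescaled datum on the unit annulus
  set g : EuclideanSpace ℝ (Fin 3) → ℝ := fun y => ρ * f (ρ • y) with hgdef
  have hg : ContDiff ℝ (⊤ : ℕ∞) g := contDiff_const.mul (hf.comp (contDiff_const_smul ρ))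
  have hgsupp : tsupport g ⊆ {y : EuclideanSpace ℝ (Fin 3) | 1 / 2 < ‖y‖ ∧ ‖y‖ < 3} := by
    intro y hy
    have hy' : ρ • y ∈ tsupport f := by
      by_contra hno
      have hopen : IsOpen ((fun z : EuclideanSpace ℝ (Fin 3) => ρ • z) ⁻¹' (tsupport f)ᶜ) :=
        (isClosed_tsupport f).isOpen_compl.preimage (continuous_const_smul ρ)
      have hzero : g =ᶠ[𝓝 y] fun _ => 0 := by
        filter_upwards [hopen.mem_nhds hno] with z hz
        simp only [hgdef, image_eq_zero_of_notMem_tsupport hz, mul_zero]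
      exact (notMem_tsupport_iff_eventuallyEq.2 hzero) hy
    have h := hsupp hy'
    simp only [mem_setOf_eq, norm_smul, Real.norm_eq_abs, abs_of_pos hρ] at h
    constructor
    · nlinarith [h.1]
    · nlinarith [h.2]
  have hgmean : ∫ y, g y = 0 := by
    simp only [hgdef]
    rw [integral_const_mul, DepletionLadder.integral_comp_smul_three hρ, hmean, mul_zero, mul_zero]
  -- the unit-annulus solution and its dilation
  obtain ⟨vu, hvu, hvuc, hvusupp, hvudiv, hvu1, hvu2⟩ := hC g hg hgsupp hgmean
  set v : EuclideanSpace ℝ (Fin 3) → EuclideanSpace ℝ (Fin 3) := fun x => vu (ρ⁻¹ • x) with hvdef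
  have hv : ContDiff ℝ (⊤ : ℕ∞) v := hvu.comp (contDiff_const_smul ρ⁻¹)
  have hvsupp : tsupport v ⊆ {x : EuclideanSpace ℝ (Fin 3) | ρ / 2 < ‖x‖ ∧ ‖x‖ < 3 * ρ} := by
    intro x hx
    have hx' : ρ⁻¹ • x ∈ tsupport vu := by
      by_contra hno
      have hopen : IsOpen ((fun z : EuclideanSpace ℝ (Fin 3) => ρ⁻¹ • z) ⁻¹' (tsupport vu)ᶜ) :=
        (isClosed_tsupport vu).isOpen_compl.preimage (continuous_const_smul ρ⁻¹)
      have hzero : v =ᶠ[𝓝 x] fun _ => 0 := by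
        filter_upwards [hopen.mem_nhds hno] with z hz
        simp only [hvdef, image_eq_zero_of_notMem_tsupport hz]
      exact (notMem_tsupport_iff_eventuallyEq.2 hzero) hx
    have h := hvusupp hx'
    simp only [mem_setOf_eq, norm_smul, Real.norm_eq_abs, abs_of_pos (inv_pos.2 hρ)] at h
    rw [← div_eq_inv_mul] at h
    constructor
    · have := h.1; rw [lt_div_iff₀ hρ] at this; linarith
    · have := h.2; rw [div_lt_iff₀ hρ] at this; linarith
  have hvc : HasCompactSupport v := by
    refine HasCompactSupport.of_support_subset_isCompact (isCompact_closedBall (0 : EuclideanSpace ℝ (Fin 3)) (3 * ρ)) ?_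
    intro x hx
    have h := hvsupp (subset_tsupport _ hx)
    rw [mem_closedBall, dist_zero_right]
    exact h.2.le
  have hvdiv : ∀ x, VectorCalculus.divergence v x = f x := by
    intro x
    unfold VectorCalculus.divergence
    rw [hvdef, _root_.fderiv_comp_smul, ContinuousLinearMap.toLinearMap_smul, LinearMap.map_smul]
    have h := hvudiv (ρ⁻¹ • x)
    unfold VectorCalculus.divergence at h
    rw [h, hgdef, smul_eq_mul]
    simp only [smul_smul, mul_inv_cancel₀ hρ0, one_smul]
    field_simp
  -- the estimates
  have a_def : (1 / q).toReal = 1 / q.toReal := by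
    rw [ENNReal.toReal_div, ENNReal.toReal_one]
  have hfac1 : eLpNorm (fun x => fderiv ℝ v x) q volume =
      ‖ρ⁻¹‖ₑ * ENNReal.ofReal |((ρ⁻¹) ^ 3)⁻¹| ^ (1 / q).toReal * eLpNorm (fun y => fderiv ℝ vu y) q volume := by
    have hpt : (fun x => fderiv ℝ v x) = fun x => ρ⁻¹ • fderiv ℝ vu (ρ⁻¹ • x) := by
      funext x; rw [hvdef, _root_.fderiv_comp_smul]
    have e1 : eLpNorm (fun x => ρ⁻¹ • fderiv ℝ vu (ρ⁻¹ • x)) q volume =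
        ‖ρ⁻¹‖ₑ * eLpNorm (fun x => fderiv ℝ vu (ρ⁻¹ • x)) q volume :=
      eLpNorm_const_smul ρ⁻¹ (fun x => fderiv ℝ vu (ρ⁻¹ • x)) q volume
    have e2 : eLpNorm (fun x => fderiv ℝ vu (ρ⁻¹ • x)) q volume =
        ENNReal.ofReal |((ρ⁻¹) ^ 3)⁻¹| ^ (1 / q).toReal * eLpNorm (fun y => fderiv ℝ vu y) q volume :=
      eLpNorm_comp_smul_three' q (fun y => fderiv ℝ vu y) (inv_ne_zero hρ0)
    rw [hpt, e1, e2, mul_assoc]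
  have hgnorm : eLpNorm g q volume = ‖ρ‖ₑ * ENNReal.ofReal |(ρ ^ 3)⁻¹| ^ (1 / q).toReal * eLpNorm f q volume := by
    have hpt : g = fun y => ρ • f (ρ • y) := by funext y; rw [hgdef, smul_eq_mul]
    have e1 : eLpNorm (fun y => ρ • f (ρ • y)) q volume = ‖ρ‖ₑ * eLpNorm (fun y => f (ρ • y)) q volume :=
      eLpNorm_const_smul ρ (fun y => f (ρ • y)) q volume
    have e2 : eLpNorm (fun y => f (ρ • y)) q volume = ENNReal.ofReal |(ρ ^ 3)⁻¹| ^ (1 / q).toReal * eLpNorm f q volume :=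
      eLpNorm_comp_smul_three' q f hρ0
    rw [hpt, e1, e2, mul_assoc]
  have hDgnorm : eLpNorm (fun y => fderiv ℝ g y) q volume =
      ‖ρ‖ₑ * ‖ρ‖ₑ * ENNReal.ofReal |(ρ ^ 3)⁻¹| ^ (1 / q).toReal * eLpNorm (fun x => fderiv ℝ f x) q volume := by
    have hpt : (fun y => fderiv ℝ g y) = fun y => (ρ * ρ) • fderiv ℝ f (ρ • y) := by
      funext y
      rw [hgdef]
      rw [show (fun y : EuclideanSpace ℝ (Fin 3) => ρ * f (ρ • y)) = fun y => ρ • f (ρ • y) from rfl,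
        fderiv_const_smul_comp_smul_apply]
    have e1 : eLpNorm (fun y => (ρ * ρ) • fderiv ℝ f (ρ • y)) q volume =
        ‖ρ * ρ‖ₑ * eLpNorm (fun y => fderiv ℝ f (ρ • y)) q volume :=
      eLpNorm_const_smul (ρ * ρ) (fun y => fderiv ℝ f (ρ • y)) q volume
    have e2 : eLpNorm (fun y => fderiv ℝ f (ρ • y)) q volume =
        ENNReal.ofReal |(ρ ^ 3)⁻¹| ^ (1 / q).toReal * eLpNorm (fun x => fderiv ℝ f x) q volume :=
      eLpNorm_comp_smul_three' q (fun x => fderiv ℝ f x) hρ0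
    rw [hpt, e1, e2, enorm_mul]
    ring
  have hfac2 : eLpNorm (fun x => fderiv ℝ (fderiv ℝ v) x) q volume =
      ‖ρ⁻¹ ^ 2‖ₑ * ENNReal.ofReal |((ρ⁻¹) ^ 3)⁻¹| ^ (1 / q).toReal *
        eLpNorm (fun y => fderiv ℝ (fderiv ℝ vu) y) q volume := by
    have hpt : (fun x => fderiv ℝ (fderiv ℝ v) x) = fun x => ρ⁻¹ ^ 2 • fderiv ℝ (fderiv ℝ vu) (ρ⁻¹ • x) := by
      funext x
      rw [hvdef, fderiv_fderiv_comp_smul]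
    have e1 : eLpNorm (fun x => ρ⁻¹ ^ 2 • fderiv ℝ (fderiv ℝ vu) (ρ⁻¹ • x)) q volume =
        ‖ρ⁻¹ ^ 2‖ₑ * eLpNorm (fun x => fderiv ℝ (fderiv ℝ vu) (ρ⁻¹ • x)) q volume :=
      eLpNorm_const_smul (ρ⁻¹ ^ 2) (fun x => fderiv ℝ (fderiv ℝ vu) (ρ⁻¹ • x)) q volume
    have e2 : eLpNorm (fun x => fderiv ℝ (fderiv ℝ vu) (ρ⁻¹ • x)) q volume =
        ENNReal.ofReal |((ρ⁻¹) ^ 3)⁻¹| ^ (1 / q).toReal * eLpNorm (fun y => fderiv ℝ (fderiv ℝ vu) y) q volume :=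
      eLpNorm_comp_smul_three' q (fun y => fderiv ℝ (fderiv ℝ vu) y) (inv_ne_zero hρ0)
    rw [hpt, e1, e2, mul_assoc]
  -- second derivatives of `vu` and `v` as `iteratedFDeriv 2`
  have hiter' : ∀ (φ : EuclideanSpace ℝ (Fin 3) → EuclideanSpace ℝ (Fin 3)), eLpNorm (fun x => iteratedFDeriv ℝ 2 φ x) q volume =
      eLpNorm (fun x => fderiv ℝ (fderiv ℝ φ) x) q volume := by
    intro φ
    refine eLpNorm_congr_norm_ae (ae_of_all _ fun x => ?_)
    rw [← norm_iteratedFDeriv_fderiv, norm_iteratedFDeriv_one]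
  have hK1 := scaleFactors_mul_eq_one hρ0 ((1 / q).toReal)
  have hK2 := enorm_mul_enorm_inv hρ0
  refine ⟨v, hv, hvc, hvsupp, hvdiv, ?_, ?_⟩
  · -- first derivatives: exact scale invariance
    rw [hfac1]
    calc ‖ρ⁻¹‖ₑ * ENNReal.ofReal |((ρ⁻¹) ^ 3)⁻¹| ^ (1 / q).toReal * eLpNorm (fun y => fderiv ℝ vu y) q volume
        ≤ ‖ρ⁻¹‖ₑ * ENNReal.ofReal |((ρ⁻¹) ^ 3)⁻¹| ^ (1 / q).toReal * (C * eLpNorm g q volume) := by gcongr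
      _ = C * eLpNorm f q volume := by
          rw [hgnorm]
          calc ‖ρ⁻¹‖ₑ * ENNReal.ofReal |((ρ⁻¹) ^ 3)⁻¹| ^ (1 / q).toReal *
                (↑C * (‖ρ‖ₑ * ENNReal.ofReal |(ρ ^ 3)⁻¹| ^ (1 / q).toReal * eLpNorm f q volume))
              = ↑C * (‖ρ‖ₑ * ‖ρ⁻¹‖ₑ) *
                  (ENNReal.ofReal |((ρ⁻¹) ^ 3)⁻¹| ^ (1 / q).toReal * ENNReal.ofReal |(ρ ^ 3)⁻¹| ^ (1 / q).toReal) *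
                  eLpNorm f q volume := by ring
            _ = C * eLpNorm f q volume := by rw [hK1, hK2, mul_one, mul_one]
  · -- second derivatives
    rw [hfac2, ← hiter' vu]
    have h2 := hvu2
    calc ‖ρ⁻¹ ^ 2‖ₑ * ENNReal.ofReal |((ρ⁻¹) ^ 3)⁻¹| ^ (1 / q).toReal * eLpNorm (fun y => iteratedFDeriv ℝ 2 vu y) q volume
        ≤ ‖ρ⁻¹ ^ 2‖ₑ * ENNReal.ofReal |((ρ⁻¹) ^ 3)⁻¹| ^ (1 / q).toReal *
            (C * (eLpNorm g q volume + eLpNorm (fun y => fderiv ℝ g y) q volume)) := by gcongr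
      _ = C * ((ENNReal.ofReal ρ)⁻¹ * eLpNorm f q volume + eLpNorm (fun x => fderiv ℝ f x) q volume) := by
          rw [hgnorm, hDgnorm]
          have hρinv : ‖ρ⁻¹ ^ 2‖ₑ * ‖ρ‖ₑ = (ENNReal.ofReal ρ)⁻¹ := by
            rw [enorm_pow, pow_two, mul_assoc, mul_comm ‖ρ⁻¹‖ₑ ‖ρ‖ₑ, hK2, mul_one,
              Real.enorm_eq_ofReal (inv_pos.2 hρ).le, ENNReal.ofReal_inv_of_pos hρ]
          have hρinv2 : ‖ρ⁻¹ ^ 2‖ₑ * (‖ρ‖ₑ * ‖ρ‖ₑ) = 1 := by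
            rw [enorm_pow, pow_two]
            calc ‖ρ⁻¹‖ₑ * ‖ρ⁻¹‖ₑ * (‖ρ‖ₑ * ‖ρ‖ₑ) = (‖ρ‖ₑ * ‖ρ⁻¹‖ₑ) * (‖ρ‖ₑ * ‖ρ⁻¹‖ₑ) := by ring
              _ = 1 := by rw [hK2, one_mul]
          calc ‖ρ⁻¹ ^ 2‖ₑ * ENNReal.ofReal |((ρ⁻¹) ^ 3)⁻¹| ^ (1 / q).toReal *
                (↑C * (‖ρ‖ₑ * ENNReal.ofReal |(ρ ^ 3)⁻¹| ^ (1 / q).toReal * eLpNorm f q volume +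
                  ‖ρ‖ₑ * ‖ρ‖ₑ * ENNReal.ofReal |(ρ ^ 3)⁻¹| ^ (1 / q).toReal * eLpNorm (fun x => fderiv ℝ f x) q volume))
              = ↑C * ((‖ρ⁻¹ ^ 2‖ₑ * ‖ρ‖ₑ) *
                    (ENNReal.ofReal |((ρ⁻¹) ^ 3)⁻¹| ^ (1 / q).toReal * ENNReal.ofReal |(ρ ^ 3)⁻¹| ^ (1 / q).toReal) *
                    eLpNorm f q volume +
                  (‖ρ⁻¹ ^ 2‖ₑ * (‖ρ‖ₑ * ‖ρ‖ₑ)) *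
                    (ENNReal.ofReal |((ρ⁻¹) ^ 3)⁻¹| ^ (1 / q).toReal * ENNReal.ofReal |(ρ ^ 3)⁻¹| ^ (1 / q).toReal) *
                    eLpNorm (fun x => fderiv ℝ f x) q volume) := by ring
            _ = C * ((ENNReal.ofReal ρ)⁻¹ * eLpNorm f q volume + eLpNorm (fun x => fderiv ℝ f x) q volume) := by
                rw [hρinv, hρinv2, hK1]; simp only [mul_one, one_mul]

end ExtremiserLiouville

end Summit.NavierStokesRegularity.NavierStokesRegularity.Theorems

end
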